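import Literature.Geometry.GeometricMeasureTheory.CurrentsAdmissibleCycle
import Literature.Geometry.GeometricMeasureTheory.CurrentsHomotopyRectifiable
import Literature.Geometry.GeometricMeasureTheory.CubicalPolyhedral
import Literature.Geometry.GeometricMeasureTheory.CubicalSmooth
import Literature.Geometry.GeometricMeasureTheory.CurrentsNullSupport
import Literature.Geometry.GeometricMeasureTheory.FlatComplete
import HarnessLib

/-!
# The deformation theorem for integral cycles, and total boundedness (Federer 4.2.9, 4.2.17)

Support file for the proof of the named fact
`Literature.Geometry.GeometricMeasureTheory.Federer1969_compactness_integralCurrents`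
(Federer–Fleming compactness, [Federer1969, 4.2.17 (2)]). This file assembles the **deformation
theorem** [Federer1969, 4.2.9] for CYCLES (the general statement of 4.2.17 is reduced to cycles by
subtracting cones over boundaries), from the bricks of this directory: the cubical subdivision and
its retractions (`CubicalSubdivision`, `CubicalModel`, `CubicalSmooth`, `CubicalAverage`), the
admissible push-forward and homotopy of Federer 4.2.2 (`CurrentsAdmissiblePushforward/Homotopy`,
cycle formulas in every degree `CurrentsAdmissibleCycle`), their rectifiability
(`CurrentsLipschitzRectifiable`, `CurrentsHomotopyRectifiable`, sibling
`PushforwardProductRectifiable`), and the polyhedral structure / finiteness (`CubicalPolyhedral`).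

* `Cubical.transV`, `Cubical.gσ`, `Cubical.vσ` — the translation `a_V = b(ε a)`, the translated
  retractions `gᵢ = σᵢ^ε ∘ τ_a` and control function `v = u_{k+1}^ε ∘ τ_a`; admissibility with
  constant `8 n √n ε` (`admissible_gσ`, from 4.2.6), `‖g_{i+1} − gᵢ‖ ≤ 2√n ε`, `gᵢ({v > 0}) ⊆ μ_ε W'_i`,
  smoothness off the null singular grid, `gₙ = τ_a`; the weight identity
  `∫ (1/v)^{k+1} d‖T‖ = ε^{-(k+1)} ∫ u_{k+1}^{-(k+1)}(model x + a) d‖T‖` (`lintegral_admWeight_vσ_eq`).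
* `Current.admPushLim_eq_lipPushforward` — for a globally Lipschitz admissible `g`,
  `g_{#v} S = g_# S` (Federer 4.1.14 / 4.2.2).
* `Current.IsRectifiable.exists_deformation_of_cycle` — **deformation of a cycle**: for
  `T ∈ 𝓡_{k+1}(V)`, `∂T = 0`, `k + 1 ≤ n`, `ε > 0`: `T = P + ∂S` with `P ∈ 𝓡_{k+1}`, `∂P = 0`,
  `spt P ⊆ μ_ε W'_{k+1}`, `S ∈ 𝓡_{k+2}`, supports within `3√n ε` of `spt T`,
  `𝐌(P) ≤ γ_P 𝐌(T)`, `𝐌(S) ≤ ε γ_S 𝐌(T)` (`γ_P = (64n²)^{k+1} 4C(n,k+1)/2ⁿ`,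
  `γ_S = 2n² 15^{k+1} γ_P + √n`). Proof as in 4.2.9: a good translation `a` (4.2.7–4.2.8,
  `exists_good_translateV'`: finite weight, null discontinuity and singular sets), the chain
  `P = (g_{k+1})_{#v} T`, `(g_{i+1})_{#v} T − (gᵢ)_{#v} T = ∂ H_v(gᵢ, g_{i+1}) T` (cycle formula),
  `(gₙ)_{#v} T = (τ_a)_# T`, and `T − (τ_a)_# T = ∂ h_#([0,1] × T)` (affine homotopy formula).
* `Current.exists_finite_flatNet_cycles` — **total boundedness** [Federer1969, 4.2.17, proof]: for
  `δ > 0` a finite set of integral polyhedral cycles `δ`-dense in `integralFlatNorm` among the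
  integral cycles with `spt ⊆ 𝔹(x₀, ρ)`, `𝐌 ≤ c`.

Definitions with bodies (`transV`, `gσ`, `vσ`, `deformConstP/S`) + theorems; no named facts.

## References

* H. Federer, *Geometric Measure Theory*, Springer 1969, 4.1.9, 4.1.14, 4.2.2, 4.2.6–4.2.9, 4.2.17
  (held copy `lit book:federernd-geometric-measure-theory`, PDF pp. 318–320, 336–337, 340–345, 351)
  [Federer1969].
-/

noncomputable section

open scoped Distributions ENNReal NNReal Topology ContDiff InnerProductSpace RealInnerProductSpace
open MeasureTheory TopologicalSpace Set Filter Metric Function Module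

namespace Literature.Geometry.GeometricMeasureTheory

set_option maxSynthPendingDepth 2

namespace Cubical

/-! ### The translated retractions `σᵢ ∘ τ_a` and the control function `u_{k+1}^ε ∘ τ_a` -/

section Translated

variable {V : Type*} [NormedAddCommGroup V] [InnerProductSpace ℝ V] {n : ℕ}
  (b : OrthonormalBasis (Fin n) ℝ V) (ε : ℝ) (a : Fin n → ℝ)

/-- The translation vector `a_V = b(ε a)`. [cite: Federer1969, 4.2.9] -/
def transV : V := uncoord b (ε • a)

/-- The translated retraction `gᵢ = σᵢ^ε ∘ τ_a`. [cite: Federer1969, 4.2.9] -/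
def gσ (i : ℕ) (x : V) : V := sigmaV b i ε (x + transV b ε a)

/-- The translated control function `v = u_{m}^ε ∘ τ_a` (`m = k + 1`). [cite: Federer1969, 4.2.9] -/
def vσ (m : ℕ) (x : V) : ℝ := uV b m ε (x + transV b ε a)

variable {ε a}

omit [NormedAddCommGroup V] [InnerProductSpace ℝ V] b in
/-- Coordinates of a point of `[−1,1]ⁿ` are bounded by `1`. [folklore] -/
theorem abs_le_one_of_mem_transCube {a : Fin n → ℝ} (ha : a ∈ transCube n) (i : Fin n) : |a i| ≤ 1 :=
  abs_le.2 (ha i (Set.mem_univ _))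

/-- `‖a_V‖ ≤ √n ε` for `a ∈ [−1,1]ⁿ`. [folklore] -/
theorem norm_transV_le (hε : 0 ≤ ε) {a : Fin n → ℝ} (ha : a ∈ transCube n) : ‖transV b ε a‖ ≤ Real.sqrt n * ε := by
  unfold transV
  have h1 : ‖uncoord b (ε • a)‖ ≤ Real.sqrt n * ‖ε • a‖ := by
    have := dist_uncoord_le b (ε • a) 0
    simpa [uncoord] using this
  refine h1.trans (mul_le_mul_of_nonneg_left ?_ (Real.sqrt_nonneg _))
  rw [norm_smul, Real.norm_eq_abs, abs_of_nonneg hε]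
  refine mul_le_of_le_one_right hε ?_
  refine (pi_norm_le_iff_of_nonneg zero_le_one).2 fun i => ?_
  rw [Real.norm_eq_abs]; exact abs_le_one_of_mem_transCube ha i

/-- `model(x + a_V) = model x + a`. [folklore] -/
theorem model_add_transV (hε : ε ≠ 0) (x : V) : model b ε (x + transV b ε a) = model b ε x + a :=
  model_add_uncoord b hε x a

/-- `v(x) = ε u_m(model x + a)`. [folklore] -/
theorem vσ_eq (hε : ε ≠ 0) (m : ℕ) (x : V) : vσ b ε a m x = ε * u m (model b ε x + a) := by
  unfold vσ uV; rw [model_add_transV b hε]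

/-- `0 ≤ v`. [folklore] -/
theorem vσ_nonneg (hε : 0 ≤ ε) (m : ℕ) (x : V) : 0 ≤ vσ b ε a m x := uV_nonneg b hε _

/-- `v ≤ ε`. [folklore] -/
theorem vσ_le (hε : 0 ≤ ε) (m : ℕ) (x : V) : vσ b ε a m x ≤ ε := uV_le b hε _

/-- `v` is `1`-Lipschitz. [cite: Federer1969, 4.2.6] -/
theorem lipschitzWith_vσ (hε : 0 < ε) (m : ℕ) : LipschitzWith 1 (vσ b ε a m) :=
  LipschitzWith.of_dist_le_mul fun x y => by
    unfold vσ
    have := (lipschitzWith_uV b (m := m) hε).dist_le_mul (x + transV b ε a) (y + transV b ε a)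
    simpa using this

/-- `u_m ∘ τ_a` is monotone in `m`. [folklore] -/
theorem vσ_mono (hε : 0 ≤ ε) {m m' : ℕ} (h : m ≤ m') (x : V) : vσ b ε a m x ≤ vσ b ε a m' x := by
  unfold vσ uV
  exact mul_le_mul_of_nonneg_left (u_mono h _) hε

/-- **Admissibility** of `gᵢ = σᵢ ∘ τ_a` with respect to `v = u_m ∘ τ_a` for `m ≤ i`, constant
`C = 8 n √n ε` [Federer1969, 4.2.9: "Lip(σ_m ∘ τ_a | U_r) ≤ 4n ε/(r − …)" via 4.2.6].
[cite: Federer1969, 4.2.6, 4.2.9] -/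
theorem admissible_gσ (hε : 0 < ε) (hn : 0 < n) {m i : ℕ} (h : m ≤ i) :
    Admissible (vσ b ε a m) (gσ b ε a i) (8 * n * Real.sqrt n * ε) := by
  intro r hr x hx y
  unfold gσ
  have hx' : r ≤ uV b i ε (x + transV b ε a) := hx.trans (vσ_mono b hε.le h x)
  have := dist_sigmaV_le_of_le_uV b hε hn hr hx' (y + transV b ε a)
  simpa [dist_eq_norm] using this

/-- `gᵢ` is the translation for `i ≥ n`. [folklore] -/
theorem gσ_of_le (hε : ε ≠ 0) {i : ℕ} (h : n ≤ i) (x : V) : gσ b ε a i x = x + transV b ε a := by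
  unfold gσ sigmaV
  rw [sigma_eq_self_of_le h, uncoord_smul_model b hε]

/-- `‖gᵢ x − x‖ ≤ 2 √n ε`. [cite: Federer1969, 4.2.9] -/
theorem dist_gσ_self_le (hε : 0 < ε) {a : Fin n → ℝ} (ha : a ∈ transCube n) (i : ℕ) (x : V) :
    dist (gσ b ε a i x) x ≤ 2 * Real.sqrt n * ε := by
  unfold gσ
  calc dist (sigmaV b i ε (x + transV b ε a)) x
      ≤ dist (sigmaV b i ε (x + transV b ε a)) (x + transV b ε a) + dist (x + transV b ε a) x := dist_triangle _ _ _
    _ ≤ Real.sqrt n * ε + Real.sqrt n * ε := by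
        refine add_le_add (dist_sigmaV_self_le b hε _) ?_
        rw [dist_eq_norm, add_sub_cancel_left]
        exact norm_transV_le b hε.le ha
    _ = 2 * Real.sqrt n * ε := by ring

/-- `‖g_{i+1} x − gᵢ x‖ ≤ 2 √n ε`. [cite: Federer1969, 4.2.9] -/
theorem norm_gσ_succ_sub_le (hε : 0 < ε) (i : ℕ) (x : V) :
    ‖gσ b ε a (i + 1) x - gσ b ε a i x‖ ≤ 2 * Real.sqrt n * ε := by
  unfold gσ
  rw [← dist_eq_norm]
  calc _ ≤ dist (sigmaV b (i + 1) ε (x + transV b ε a)) (x + transV b ε a) +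
        dist (x + transV b ε a) (sigmaV b i ε (x + transV b ε a)) := dist_triangle _ _ _
    _ ≤ Real.sqrt n * ε + Real.sqrt n * ε := add_le_add (dist_sigmaV_self_le b hε _)
        (by rw [dist_comm]; exact dist_sigmaV_self_le b hε _)
    _ = 2 * Real.sqrt n * ε := by ring

/-- `gᵢ` maps `{v > 0}` into the scaled `i`-skeleton (`m ≤ i`). [cite: Federer1969, 4.2.6, 4.2.9] -/
theorem gσ_mem_skeletonV (hε : 0 < ε) {m i : ℕ} (h : m ≤ i) {x : V} (hx : 0 < vσ b ε a m x) :
    gσ b ε a i x ∈ skeletonV b i ε :=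
  sigmaV_mem_skeletonV b hε (lt_of_lt_of_le hx (vσ_mono b hε.le h x))

/-- `gᵢ` is smooth at points whose translate has no integer or tied coordinates. [folklore] -/
theorem contDiffAt_gσ (i : ℕ) {x : V} (hx : model b ε (x + transV b ε a) ∈ regularSet n) :
    ContDiffAt ℝ ∞ (gσ b ε a i) x := by
  have h : ContDiffAt ℝ ∞ (fun y : V => y + transV b ε a) x := contDiffAt_id.add contDiffAt_const
  exact (contDiffAt_sigmaV b i ε hx).comp x h

/-- The regular set of the translated grid is open. [folklore] -/
theorem isOpen_regularV : IsOpen {x : V | model b ε (x + transV b ε a) ∈ regularSet n} :=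
  isOpen_regularSet.preimage ((contDiff_model b ε).continuous.comp (continuous_id.add continuous_const))

end Translated

/-! ### The weight `∫ (1/v)^{k+1} d‖T‖` after a good translation -/

section Weight

variable {V : Type*} [NormedAddCommGroup V] [InnerProductSpace ℝ V] [FiniteDimensional ℝ V]
  [MeasurableSpace V] [BorelSpace V] {n : ℕ} (b : OrthonormalBasis (Fin n) ℝ V) {ε : ℝ} {a : Fin n → ℝ}

omit [FiniteDimensional ℝ V] [MeasurableSpace V] [BorelSpace V] in
/-- `(1/v)^{k+1} = ε^{-(k+1)} u_{k+1}^{-(k+1)}(model x + a)` where `u_{k+1} > 0`. [folklore] -/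
theorem admWeight_vσ_eq (hε : 0 < ε) (k : ℕ) {x : V} (hx : 0 < u (k + 1) (model b ε x + a)) :
    admWeight (vσ b ε a (k + 1)) k x =
      ENNReal.ofReal (ε⁻¹ ^ (k + 1)) * ENNReal.ofReal (upow (k + 1) (model b ε x + a)) := by
  unfold admWeight upow
  rw [vσ_eq b hε.ne', ← ENNReal.ofReal_inv_of_pos (mul_pos hε hx), ← ENNReal.ofReal_pow (inv_nonneg.2 (by positivity)),
    mul_inv, mul_pow, ENNReal.ofReal_mul (by positivity)]

omit [FiniteDimensional ℝ V] [BorelSpace V] in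
/-- **The weight bound after a good translation** [Federer1969, 4.2.9 with 4.2.7–4.2.8]:
if `‖T‖{u_{k+1}(model · + a) = 0} = 0` then
`∫ (1/v)^{k+1} d‖T‖ = ε^{-(k+1)} ∫ u_{k+1}^{-(k+1)}(model x + a) d‖T‖(x)`. [cite: Federer1969, 4.2.7, 4.2.9] -/
theorem lintegral_admWeight_vσ_eq (hε : 0 < ε) (k : ℕ) (ρ : Measure V)
    (h0 : ρ {x | u (k + 1) (model b ε x + a) = 0} = 0) :
    ∫⁻ x, admWeight (vσ b ε a (k + 1)) k x ∂ρ =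
      ENNReal.ofReal (ε⁻¹ ^ (k + 1)) * ∫⁻ x, ENNReal.ofReal (upow (k + 1) (model b ε x + a)) ∂ρ := by
  rw [← lintegral_const_mul' _ _ ENNReal.ofReal_ne_top]
  refine lintegral_congr_ae ?_
  have : ∀ᵐ x ∂ρ, x ∉ {x | u (k + 1) (model b ε x + a) = 0} := measure_eq_zero_iff_ae_notMem.1 h0
  filter_upwards [this] with x hx
  exact admWeight_vσ_eq b hε k (lt_of_le_of_ne (u_nonneg _ _) (Ne.symm hx))

end Weight

end Cubical

/-! ### The admissible push-forward along a globally Lipschitz map -/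

section AdmissibleLipschitz

open Cubical

variable {V : Type*} [NormedAddCommGroup V] [InnerProductSpace ℝ V] [FiniteDimensional ℝ V]
  [MeasurableSpace V] [BorelSpace V] {n d : ℕ} {v : V → ℝ} {g : V → V} {C : ℝ}
  {S : Current (⊤ : Opens V) (d + 1)}

/-- `‖S‖{v ≤ r_j} → 0` along a good sequence when `∫ (1/v)^{d+1} d‖S‖ < ∞`. [folklore] -/
theorem Current.tendsto_variation_sublevel_goodSeq (hS : S.mass ≠ ⊤) (hv : LipschitzWith 1 v) {ε : ℝ} (hε : 0 < ε)
    {P : ℝ → Prop} (R : S.GoodSeq hS hv.continuous ε P) (hI : ∫⁻ x, admWeight v d x ∂S.variation ≠ ⊤) :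
    Tendsto (fun j => S.variation {x | v x ≤ R.r j}) atTop (𝓝 0) := by
  have h0 : S.variation {x | v x ≤ 0} = 0 := by
    by_contra hne
    apply hI
    refine eq_top_iff.2 (le_trans ?_ (setLIntegral_le_lintegral {x | v x ≤ 0} _))
    have : ∫⁻ x in {x | v x ≤ 0}, admWeight v d x ∂S.variation = ∫⁻ _ in {x | v x ≤ 0}, ⊤ ∂S.variation :=
      setLIntegral_congr_fun (isClosed_le hv.continuous continuous_const).measurableSet fun x hx =>
        admWeight_eq_top hx
    rw [this, setLIntegral_const, ENNReal.top_mul hne]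
  have h1 := S.tendsto_variation_sublevel_of_null hS hv.continuous hε h0
  refine tendsto_of_tendsto_of_tendsto_of_le_of_le tendsto_const_nhds h1 (fun j => bot_le) fun j => ?_
  exact measure_mono fun x (hx : v x ≤ R.r j) => hx.trans (R.upper j)

/-- **For a globally Lipschitz admissible `g`, `g_{#v} S = g_# S`**: the restricted push-forwards
`(G_{r_j})_# (S ⌞ {v > r_j}) = g_# (S ⌞ {v > r_j})` differ from `g_# S` by `g_# (S ⌞ {v ≤ r_j})`, of mass
`≤ Lip(g)^{d+1} ‖S‖{v ≤ r_j} → 0`. [cite: Federer1969, 4.1.14, 4.2.2] -/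
theorem Current.admPushLim_eq_lipPushforward (b : OrthonormalBasis (Fin n) ℝ V) (hS : S.mass ≠ ⊤)
    (hdS : S.boundary.mass ≠ ⊤) (hsupp : IsCompact S.support) (hv : LipschitzWith 1 v) (hadm : Admissible v g C)
    (hC : 0 ≤ C) {L : ℝ≥0} (hg : LipschitzWith L g) {ε : ℝ} (hε : 0 < ε) {P : ℝ → Prop}
    (R : S.GoodSeq hS hv.continuous ε P) (hvε : ∀ x, v x ≤ ε) (hI : ∫⁻ x, admWeight v d x ∂S.variation ≠ ⊤) :
    S.admPushLim b hS hsupp hv.continuous hadm hC hε R hvε hI = S.lipPushforward hS hdS hsupp hg ⊤ := by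
  set hT := S.isRepresentable_of_mass_ne_top hS
  ext φ
  have t1 := S.tendsto_admPush b hS hsupp hv.continuous hadm hC hε R hvε hI φ
  obtain ⟨Cφ, hCφ, hφ⟩ := φ.exists_norm_le
  -- `P_{r_j} = g_# X_j` and `g_# S = g_# X_j + g_# Y_j`
  have hkey : ∀ j, ∃ Yj : Current (⊤ : Opens V) (d + 1), Yj.mass ≠ ⊤ ∧
      S.admPush b hS hsupp hv.continuous hadm hC (R.pos hε j) (R.good j) φ + Yj φ = S.lipPushforward hS hdS hsupp hg ⊤ φ ∧
      Yj.mass ≤ (L : ℝ≥0∞) ^ (d + 1) * S.variation {x | v x ≤ R.r j} := by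
    intro j
    set r := R.r j
    have hr : 0 < r := R.pos hε j
    set X := S.restrictAbove hS hv.continuous r with hX
    set Y := hT.restrictSet {x | v x ≤ r} (isClosed_le hv.continuous continuous_const).measurableSet with hY
    have hXm : X.mass ≠ ⊤ := S.mass_restrictAbove_ne_top hS hv.continuous r
    have hXc : IsCompact X.support := S.isCompact_support_restrictAbove hS hsupp hv.continuous r
    have hsplit : S = X + Y := by
      rw [hX, hY, Current.restrictAbove, ← hT.restrictSet_union]
      · conv_lhs => rw [← hT.restrictSet_univ]
        have : ∀ (A B : Set V) (hA : MeasurableSet A) (hB : MeasurableSet B), A = B →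
            hT.restrictSet A hA = hT.restrictSet B hB := by
          intro A B hA hB h; subst h; rfl
        refine this _ _ _ _ ?_
        ext x; simp only [Set.mem_univ, Set.mem_union, Set.mem_setOf_eq, true_iff]; exact lt_or_ge _ _
      · exact Set.disjoint_left.2 fun x (hx : r < v x) (hx' : v x ≤ r) => (not_le.2 hx) hx'
    have hYm : Y.mass ≠ ⊤ := Current.mass_restrictSet_ne_top' _ hS _
    have hYb : Y.boundary.mass ≠ ⊤ := by
      have e : Y = S - X := by rw [hsplit]; abel
      rw [e, sub_eq_add_neg, Current.boundary_add, Current.boundary_neg]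
      refine ne_top_of_le_ne_top (ENNReal.add_ne_top.2 ⟨hdS, ?_⟩) (Current.mass_add_le _ _)
      rw [Current.mass_neg]; exact R.good j
    have hYc : IsCompact Y.support :=
      Current.isCompact_support_of_subset _ hsupp (Current.support_subset _) (hT.support_restrictSet_subset _)
    have h1 : S.admPush b hS hsupp hv.continuous hadm hC hr (R.good j) = X.lipPushforward hXm (R.good j) hXc hg ⊤ := by
      unfold Current.admPush
      refine X.lipPushforward_congr hXm (R.good j) hXc (hadm.lipschitzWith_ext b hC hr) hg (N := {x | r / 2 < v x})
        (isOpen_lt continuous_const hv.continuous)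
        ((S.support_restrictAbove_subset hS hv.continuous r).trans fun x hx => ?_) fun x hx => ?_
      · show r / 2 < v x
        have : r ≤ v x := hx
        linarith
      · have hx' : r / 2 < v x := hx
        exact hadm.ext_eqOn b hC hr hx'.le
    have h2 := Current.lipPushforward_add' (Ω' := (⊤ : Opens V)) (T₁ := X) (T₂ := Y) hXm (R.good j) hXc hYm hYb hYc
      (by rw [← hsplit]; exact hS) (by rw [← hsplit]; exact hdS) (by rw [← hsplit]; exact hsupp) hg
    refine ⟨Y.lipPushforward hYm hYb hYc hg ⊤, ?_, ?_, ?_⟩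
    · exact ne_top_of_le_ne_top (ENNReal.mul_ne_top (ENNReal.pow_ne_top ENNReal.coe_ne_top) hYm)
        (Y.mass_lipPushforward_le hYm hYb hYc hg)
    · rw [h1]
      have := DFunLike.congr_fun h2 φ
      rw [show (X.lipPushforward hXm (R.good j) hXc hg ⊤ + Y.lipPushforward hYm hYb hYc hg ⊤) φ =
        X.lipPushforward hXm (R.good j) hXc hg ⊤ φ + Y.lipPushforward hYm hYb hYc hg ⊤ φ from rfl] at this
      rw [← this]
      have e : ∀ (h₁ : (X + Y).mass ≠ ⊤) (h₂ : (X + Y).boundary.mass ≠ ⊤) (h₃ : IsCompact (X + Y).support),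
          (X + Y).lipPushforward h₁ h₂ h₃ hg ⊤ = S.lipPushforward hS hdS hsupp hg ⊤ := by
        intro h₁ h₂ h₃
        have : ∀ (S₁ S₂ : Current (⊤ : Opens V) (d + 1)) (e : S₁ = S₂) (h₁ : S₁.mass ≠ ⊤) (h₂ : S₁.boundary.mass ≠ ⊤)
            (h₃ : IsCompact S₁.support) (h₁' : S₂.mass ≠ ⊤) (h₂' : S₂.boundary.mass ≠ ⊤) (h₃' : IsCompact S₂.support),
            S₁.lipPushforward h₁ h₂ h₃ hg ⊤ = S₂.lipPushforward h₁' h₂' h₃' hg ⊤ := by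
          intro S₁ S₂ e; subst e; intros; rfl
        exact this _ _ hsplit.symm _ _ _ _ _ _
      rw [e]
    · refine (Y.mass_lipPushforward_le hYm hYb hYc hg).trans (mul_le_mul' le_rfl ?_)
      exact hT.mass_restrictSet_le _
  choose Y hYfin hYeq hYmass using hkey
  have hvar := S.tendsto_variation_sublevel_goodSeq hS hv hε R hI
  have hYlim : Tendsto (fun j => (Y j).mass) atTop (𝓝 0) := by
    have := ENNReal.Tendsto.const_mul (a := (L : ℝ≥0∞) ^ (d + 1)) hvar (Or.inr (ENNReal.pow_ne_top ENNReal.coe_ne_top))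
    rw [mul_zero] at this
    exact tendsto_of_tendsto_of_tendsto_of_le_of_le tendsto_const_nhds this (fun j => bot_le) hYmass
  have t2 : Tendsto (fun j => S.admPush b hS hsupp hv.continuous hadm hC (R.pos hε j) (R.good j) φ) atTop
      (𝓝 (S.lipPushforward hS hdS hsupp hg ⊤ φ)) := by
    have hY0 : Tendsto (fun j => Y j φ) atTop (𝓝 0) := by
      have hlim' : Tendsto (fun j => Cφ * ((Y j).mass).toReal) atTop (𝓝 0) := by
        have := ((ENNReal.tendsto_toReal ENNReal.zero_ne_top).comp hYlim).const_mul Cφ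
        simpa using this
      refine squeeze_zero_norm' (Eventually.of_forall fun j => ?_) hlim'
      rw [Real.norm_eq_abs]
      exact Current.abs_apply_le_mul_toReal_mass' _ (hYfin j) hCφ.le hφ
    have : Tendsto (fun j => S.lipPushforward hS hdS hsupp hg ⊤ φ - Y j φ) atTop
        (𝓝 (S.lipPushforward hS hdS hsupp hg ⊤ φ - 0)) := tendsto_const_nhds.sub hY0
    rw [sub_zero] at this
    refine this.congr fun j => ?_
    linarith [hYeq j]
  exact tendsto_nhds_unique t1 t2

end AdmissibleLipschitz

/-! ### The deformation of a cycle -/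

section DeformationCycle

open Cubical

variable {V : Type*} [NormedAddCommGroup V] [InnerProductSpace ℝ V] [FiniteDimensional ℝ V]
  [MeasurableSpace V] [BorelSpace V] {n : ℕ}

/-- The mass constant of the deformation `P`: `γ_P(n,k) = (64 n²)^{k+1} · 4 C(n,k+1)/2ⁿ`.
[cite: Federer1969, 4.2.9] -/
def Cubical.deformConstP (n k : ℕ) : ℝ := (64 * (n : ℝ) ^ 2) ^ (k + 1) * (4 * avgConst n (k + 1) / 2 ^ n)

/-- The mass constant of the deformation `S`: `γ_S(n,k) = 2 n² 15^{k+1} γ_P(n,k) + √n`.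
[cite: Federer1969, 4.2.9] -/
def Cubical.deformConstS (n k : ℕ) : ℝ := 2 * (n : ℝ) ^ 2 * 15 ^ (k + 1) * deformConstP n k + Real.sqrt n

omit [FiniteDimensional ℝ V] [MeasurableSpace V] [BorelSpace V] in
/-- `γ_P ≥ 0`. [folklore] -/
theorem Cubical.deformConstP_nonneg (n k : ℕ) : 0 ≤ deformConstP n k := by
  unfold deformConstP; have := avgConst_nonneg n (k + 1); positivity

omit [InnerProductSpace ℝ V] [FiniteDimensional ℝ V] [MeasurableSpace V] [BorelSpace V] in
/-- Boundary of a finite sum. [folklore] -/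
theorem Current.boundary_finset_sum [NormedSpace ℝ V] {m : ℕ} (S : ℕ → Current (⊤ : Opens V) (m + 1)) (N : ℕ) :
    (∑ j ∈ Finset.range N, S j).boundary = ∑ j ∈ Finset.range N, (S j).boundary := by
  induction N with
  | zero => simp [Current.boundary]
  | succ N ih => rw [Finset.sum_range_succ, Finset.sum_range_succ, Current.boundary_add, ih]

omit [InnerProductSpace ℝ V] [FiniteDimensional ℝ V] [MeasurableSpace V] [BorelSpace V] in
/-- Mass of a finite sum. [folklore] -/
theorem Current.mass_finset_sum_le [NormedSpace ℝ V] {m : ℕ} (S : ℕ → Current (⊤ : Opens V) m) (N : ℕ) :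
    (∑ j ∈ Finset.range N, S j).mass ≤ ∑ j ∈ Finset.range N, (S j).mass := by
  induction N with
  | zero => simp
  | succ N ih =>
    rw [Finset.sum_range_succ, Finset.sum_range_succ]
    exact (Current.mass_add_le _ _).trans (add_le_add ih le_rfl)

/-- **The deformation theorem for cycles** [Federer1969, 4.2.9, case `∂T = 0`]. For an integral
cycle `T ∈ 𝓡_{k+1}(V)`, `∂T = 0`, `k + 1 ≤ n = dim V`, and `ε > 0` there are `P ∈ 𝓡_{k+1}` and
`S ∈ 𝓡_{k+2}` with
`T = P + ∂S`, `∂P = 0`, `spt P ⊆ μ_ε W'_{k+1}` (so `P` is an integral polyhedral chain of the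
`ε`-subdivision, `CubicalPolyhedral.lean`), supports within `3√n ε` of `spt T`,
`𝐌(P) ≤ γ_P 𝐌(T)` and `𝐌(S) ≤ ε γ_S 𝐌(T)`. Here `P = (σ_{k+1} ∘ τ_a)_{#v} T` and
`S = Σ_{i=k+1}^{n−1} H_v(σ_i ∘ τ_a, σ_{i+1} ∘ τ_a) T + h_#([0,1] × T)` (affine homotopy from `τ_a`
to the identity), for a good translation `a` (4.2.7–4.2.8 averaging, `exists_good_translateV'`).
[cite: Federer1969, 4.2.9] -/
theorem Current.IsRectifiable.exists_deformation_of_cycle (b : OrthonormalBasis (Fin n) ℝ V) {k : ℕ}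
    (hkn : k + 1 ≤ n) {ε : ℝ} (hε : 0 < ε) {T : Current (⊤ : Opens V) (k + 1)} (hT : T.IsRectifiable)
    (hcyc : T.boundary = 0) :
    ∃ (P : Current (⊤ : Opens V) (k + 1)) (S : Current (⊤ : Opens V) (k + 1 + 1)),
      T = P + S.boundary ∧ P.IsRectifiable ∧ P.boundary = 0 ∧ S.IsRectifiable ∧
      P.support ⊆ skeletonV b (k + 1) ε ∧
      P.support ⊆ cthickening (3 * Real.sqrt n * ε) T.support ∧
      S.support ⊆ cthickening (3 * Real.sqrt n * ε) T.support ∧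
      P.mass ≤ ENNReal.ofReal (deformConstP n k) * T.mass ∧
      S.mass ≤ ENNReal.ofReal (ε * deformConstS n k) * T.mass := by
  classical
  /- Step 0: basics. -/
  have hn : 0 < n := by omega
  have hTm : T.mass ≠ ⊤ := hT.mass_ne_top'
  have hdT : T.boundary.mass ≠ ⊤ := T.boundary_mass_ne_top_of_cycle hcyc
  have hsupp : IsCompact T.support := hT.2
  haveI : IsFiniteMeasure T.variation := ⟨lt_of_le_of_lt (T.variation_le_mass _) hTm.lt_top⟩
  /- Step 1: a good translation. -/
  obtain ⟨a, ha, hreg, h1, -, h3, -⟩ := exists_good_translateV' b (ε := ε) T.variation T.variation (k + 1) (k + 1)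
    (ν := fun _ : Fin 1 => T.variation)
  have hreg0 := hreg 0
  /- Step 2: control function, maps, admissibility. -/
  set v : V → ℝ := vσ b ε a (k + 1) with hvdef
  have hv : LipschitzWith 1 v := lipschitzWith_vσ b hε (k + 1)
  have hvε : ∀ x, v x ≤ ε := vσ_le b hε.le (k + 1)
  set C : ℝ := 8 * n * Real.sqrt n * ε with hCdef
  have hC : 0 ≤ C := by positivity
  set g : ℕ → V → V := fun j => gσ b ε a (k + 1 + j) with hgdef
  have hadm : ∀ j, Admissible v (g j) C := fun j => admissible_gσ b hε hn (Nat.le_add_right _ _)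
  set η₀ : ℝ := 2 * Real.sqrt n * ε with hη₀def
  have hη₀ : 0 ≤ η₀ := by positivity
  have hclose : ∀ j, ∀ x, 0 < v x → ‖g (j + 1) x - g j x‖ ≤ η₀ := fun j x _ => by
    simp only [hgdef, show k + 1 + (j + 1) = k + 1 + j + 1 by ring]
    exact norm_gσ_succ_sub_le b hε _ x
  -- the weight
  have hIeq := lintegral_admWeight_vσ_eq b hε k T.variation h1
  have hIle : ∫⁻ x, admWeight v k x ∂T.variation ≤
      ENNReal.ofReal (ε⁻¹ ^ (k + 1)) * (ENNReal.ofReal (4 * avgConst n (k + 1) / 2 ^ n) * T.mass) := by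
    rw [hvdef, hIeq]
    refine mul_le_mul' le_rfl (h3.trans (mul_le_mul' le_rfl (T.variation_le_mass _)))
  have hI : ∫⁻ x, admWeight v k x ∂T.variation ≠ ⊤ :=
    ne_top_of_le_ne_top (ENNReal.mul_ne_top ENNReal.ofReal_ne_top (ENNReal.mul_ne_top ENNReal.ofReal_ne_top hTm)) hIle
  /- Step 3: a good sequence. -/
  obtain ⟨R⟩ := T.exists_goodSeq hTm hdT hv hε (P := fun _ => True) (Eventually.of_forall fun _ => trivial)
  /- Step 4: the currents. -/
  set N : ℕ := n - (k + 1) with hN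
  have hkN : k + 1 + N = n := by omega
  set A : ℕ → Current (⊤ : Opens V) (k + 1) := fun j =>
    T.admPushLim b hTm hsupp hv.continuous (hadm j) hC hε R hvε hI with hA
  set SH : ℕ → Current (⊤ : Opens V) (k + 1 + 1) := fun j =>
    T.admHomLim b hTm hsupp hv.continuous (hadm j) (hadm (j + 1)) hC hη₀ (hclose j) hε R hvε hI with hSH
  have hstep : ∀ j, A (j + 1) - A j = (SH j).boundary := fun j =>
    T.admPushLim_sub_admPushLim_eq_of_cycle b hTm hcyc hsupp hv (hadm j) (hadm (j + 1)) hC hη₀ (hclose j) hε hvε hI R R R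
  have htel : A N - A 0 = (∑ j ∈ Finset.range N, SH j).boundary := by
    rw [Current.boundary_finset_sum, ← Finset.sum_range_sub]
    exact Finset.sum_congr rfl fun j _ => hstep j
  -- the last map is the translation
  have hgN : g N = fun x => x + transV b ε a := by
    funext x; simp only [hgdef, hkN]; exact gσ_of_le b hε.ne' le_rfl x
  have hgNlip : LipschitzWith 1 (g N) := by
    rw [hgN]; exact LipschitzWith.of_dist_le_mul fun x y => by simp
  have hgNs : ContDiff ℝ ∞ (g N) := by rw [hgN]; exact contDiff_id.add contDiff_const
  have hAN : A N = T.lipPushforward hTm hdT hsupp hgNlip ⊤ :=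
    T.admPushLim_eq_lipPushforward b hTm hdT hsupp hv (hadm N) hC hgNlip hε R hvε hI
  -- the affine homotopy from the translation to the identity
  obtain ⟨hUo, hTU, hχ1, hχabs⟩ := T.cutoff_spec hsupp
  obtain ⟨hVo, h01, hρ1, hρabs, hρ2⟩ := timeCutoff_spec
  set SL : Current (⊤ : Opens V) (k + 1 + 1) :=
    (T.prodInterval 0 1).pushforward ⊤ (TestFunction.tensorCutoff timeCutoff (T.cutoff hsupp))
      (contDiff_affineHomotopy hgNs contDiff_id) with hSL
  have hlast : T - A N = SL.boundary := by
    have h := T.homotopy_formula_affine (Ω' := (⊤ : Opens V)) (T.cutoff hsupp) timeCutoff hgNs contDiff_id hUo hTU hχ1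
      hVo h01 hρ1
    rw [T.pushforward_id (T.cutoff hsupp) hUo hTU hχ1, hcyc] at h
    have h0 : ((0 : Current (⊤ : Opens V) k).prodInterval 0 1).pushforward ⊤
        (TestFunction.tensorCutoff timeCutoff (T.cutoff hsupp)) (contDiff_affineHomotopy hgNs contDiff_id) = 0 := by
      have : (0 : Current (⊤ : Opens V) k).prodInterval 0 1 = 0 := by
        ext φ; rw [Current.prodInterval_apply]; simp
      rw [this, Current.pushforward_zero]
    rw [h0, add_zero, ← T.lipPushforward_eq_pushforward hTm hdT hsupp hgNlip hgNs, ← hAN] at h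
    exact h
  /- Step 5: localisation data: `O` (smoothness), `B ⊇ spt T` open, `K` compact, `Z` the thickening. -/
  set O : Set V := {x | model b ε (x + transV b ε a) ∈ regularSet n} with hOdef
  have hO : IsOpen O := isOpen_regularV b
  have hnull : T.variation Oᶜ = 0 := by
    have : Oᶜ = {x | model b ε x + a ∉ regularSet n} := by
      ext x; simp [hOdef, model_add_transV b hε.ne']
    rw [this]; exact hreg0
  have hgO : ∀ j, ∀ x ∈ O, ContDiffAt ℝ ∞ (g j) x := fun j x hx => contDiffAt_gσ b _ hx
  obtain ⟨ρ, hρ0, hρ⟩ := hsupp.isBounded.subset_closedBall_lt 0 0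
  set δ : ℝ := Real.sqrt n * ε with hδ
  have hδ0 : 0 ≤ δ := by positivity
  set B : Set V := thickening δ T.support with hBdef
  have hB : IsOpen B := isOpen_thickening
  have hTB : T.support ⊆ B := by
    rcases eq_or_lt_of_le hδ0 with h0 | hpos
    · -- degenerate `n = 0` is excluded; still handle `δ = 0` formally via `ε > 0, n > 0`
      exfalso
      have : 0 < δ := by rw [hδ]; exact mul_pos (Real.sqrt_pos.2 (by exact_mod_cast hn)) hε
      linarith
    · exact self_subset_thickening hpos _
  set K : Set V := closedBall (0 : V) (ρ + 3 * δ) with hKdef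
  have hK : IsCompact K := isCompact_closedBall _ _
  set Z : Set V := cthickening (3 * Real.sqrt n * ε) T.support with hZdef
  have hZc : IsClosed Z := isClosed_cthickening
  -- geometry of the maps on `B`
  have hgdist : ∀ j x, dist (g j x) x ≤ 2 * δ := fun j x => by
    rw [hδ]; have := dist_gσ_self_le b hε ha (k + 1 + j) x; linarith
  have hsegdist : ∀ j, ∀ t ∈ Set.Icc (0 : ℝ) 1, ∀ x, dist (g j x + t • (g (j + 1) x - g j x)) x ≤ 2 * δ := by
    intro j t ht x
    have e : g j x + t • (g (j + 1) x - g j x) - x = (1 - t) • (g j x - x) + t • (g (j + 1) x - x) := by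
      simp only [smul_sub, sub_smul, one_smul]; abel
    rw [dist_eq_norm, e]
    calc ‖(1 - t) • (g j x - x) + t • (g (j + 1) x - x)‖ ≤ ‖(1 - t) • (g j x - x)‖ + ‖t • (g (j + 1) x - x)‖ :=
          norm_add_le _ _
      _ ≤ (1 - t) * (2 * δ) + t * (2 * δ) := by
          rw [norm_smul, norm_smul, Real.norm_eq_abs, Real.norm_eq_abs, abs_of_nonneg (by linarith [ht.2]),
            abs_of_nonneg ht.1, ← dist_eq_norm, ← dist_eq_norm]
          exact add_le_add (mul_le_mul_of_nonneg_left (hgdist j x) (by linarith [ht.2]))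
            (mul_le_mul_of_nonneg_left (hgdist (j + 1) x) ht.1)
      _ = 2 * δ := by ring
  have hBZ : ∀ {x y : V}, x ∈ B → dist y x ≤ 2 * δ → y ∈ Z := by
    intro x y hx hyx
    obtain ⟨z, hz, hxz⟩ := mem_thickening_iff.1 hx
    refine mem_cthickening_of_dist_le y z _ _ hz ?_
    calc dist y z ≤ dist y x + dist x z := dist_triangle _ _ _
      _ ≤ 2 * δ + δ := add_le_add hyx hxz.le
      _ = 3 * Real.sqrt n * ε := by rw [hδ]; ring
  have hBK : ∀ {x y : V}, x ∈ B → dist y x ≤ 2 * δ → y ∈ K := by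
    intro x y hx hyx
    obtain ⟨z, hz, hxz⟩ := mem_thickening_iff.1 hx
    rw [hKdef, mem_closedBall, dist_zero_right]
    have hz' : ‖z‖ ≤ ρ := mem_closedBall_zero_iff.1 (hρ hz)
    calc ‖y‖ = dist y 0 := (dist_zero_right _).symm
      _ ≤ dist y x + (dist x z + dist z 0) := (dist_triangle _ _ _).trans (add_le_add le_rfl (dist_triangle _ _ _))
      _ ≤ 2 * δ + (δ + ρ) := add_le_add hyx (add_le_add hxz.le (by rwa [dist_zero_right]))
      _ = ρ + 3 * δ := by ring
  have hgZ : ∀ j, Set.MapsTo (g j) ({x | 0 < v x} ∩ B) Z := fun j x hx => hBZ hx.2 (hgdist j x)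
  have hgK : ∀ j, Set.MapsTo (g j) ({x | 0 < v x} ∩ B) K := fun j x hx => hBK hx.2 (hgdist j x)
  have hsegZ : ∀ j, ∀ t ∈ Set.Icc (0 : ℝ) 1, ∀ x ∈ {x | 0 < v x} ∩ B, g j x + t • (g (j + 1) x - g j x) ∈ Z :=
    fun j t ht x hx => hBZ hx.2 (hsegdist j t ht x)
  have hsegK : ∀ j, ∀ t ∈ Set.Icc (0 : ℝ) 1, ∀ x ∈ {x | 0 < v x} ∩ B, g j x + t • (g (j + 1) x - g j x) ∈ K :=
    fun j t ht x hx => hBK hx.2 (hsegdist j t ht x)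
  /- Step 6: rectifiability and supports of the pieces. -/
  have hPr : (A 0).IsRectifiable :=
    hT.admPushLim b hTm hsupp hv.continuous (hadm 0) hC hε R hvε hI hO (hgO 0) hnull hB hTB hK (hgK 0)
  have hSHr : ∀ j, (SH j).IsRectifiable := fun j =>
    hT.admHomLim b hTm hsupp hv.continuous (hadm j) (hadm (j + 1)) hC hη₀ (hclose j) hε R hvε hI hO (hgO j)
      (hgO (j + 1)) hnull hB hTB hK (hsegK j)
  have hχ' : ∀ p ∈ Set.Icc (0 : ℝ) 1 ×ˢ T.support, TestFunction.tensorCutoff timeCutoff (T.cutoff hsupp) p = 1 :=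
    fun p hp => by rw [TestFunction.tensorCutoff_apply, hρ1 _ (h01 hp.1), hχ1 _ (hTU hp.2), one_mul]
  have hSLr : SL.IsRectifiable := hT.pushforward_prodInterval_top _ hχ' _
  have hPZ : (A 0).support ⊆ Z := by
    show ((T.admFamily b hTm hsupp hv.continuous (hadm 0) hC).lim hε R hvε hI).support ⊆ Z
    exact (T.admFamily b hTm hsupp hv.continuous (hadm 0) hC).support_lim_subset hε R hI hvε hZc fun j =>
      T.support_admPush_subset' b hTm hsupp hv.continuous (hadm 0) hC (R.pos hε j) (R.good j) hB hTB hZc (hgZ 0)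
  have hSHZ : ∀ j, (SH j).support ⊆ Z := fun j =>
    T.support_admHomLim_subset b hTm hsupp hv.continuous (hadm j) (hadm (j + 1)) hC hη₀ (hclose j) hε R hvε hI
      hB hTB hZc (hsegZ j)
  have haV : ‖transV b ε a‖ ≤ δ := norm_transV_le b hε.le ha
  have hSLZ : SL.support ⊆ Z := by
    refine ((T.prodInterval 0 1).support_pushforward_subset _ _).trans (closure_minimal ?_ hZc)
    rintro _ ⟨p, ⟨-, hp⟩, rfl⟩
    have hp' := T.support_prodInterval_subset 0 1 hp
    rw [Set.uIcc_of_le zero_le_one] at hp'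
    refine hBZ (hTB hp'.2) ?_
    simp only [affineHomotopy, hgN, id_eq]
    rw [dist_eq_norm, show p.2 + transV b ε a + p.1 • (p.2 - (p.2 + transV b ε a)) - p.2 = (1 - p.1) • transV b ε a by
      simp only [smul_sub, sub_smul, one_smul, smul_add]; abel]
    rw [norm_smul, Real.norm_eq_abs, abs_of_nonneg (by linarith [hp'.1.2])]
    calc (1 - p.1) * ‖transV b ε a‖ ≤ 1 * δ := mul_le_mul (by linarith [hp'.1.1]) haV (norm_nonneg _) zero_le_one
      _ ≤ 2 * δ := by linarith
  /- Step 7: masses. -/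
  have hsqrt : Real.sqrt n * Real.sqrt n = n := Real.mul_self_sqrt (Nat.cast_nonneg n)
  have hconstP : admConst n C k * (ENNReal.ofReal (ε⁻¹ ^ (k + 1)) * ENNReal.ofReal (4 * avgConst n (k + 1) / 2 ^ n)) =
      ENNReal.ofReal (deformConstP n k) := by
    unfold admConst deformConstP
    have havg := avgConst_nonneg n (k + 1)
    rw [← ENNReal.ofReal_pow (by positivity), ← ENNReal.ofReal_mul (by positivity), ← ENNReal.ofReal_mul (by positivity)]
    congr 1
    have hεk : (ε * ε⁻¹) ^ (k + 1) = 1 := by rw [mul_inv_cancel₀ hε.ne', one_pow]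
    calc (8 * C * Real.sqrt n) ^ (k + 1) * (ε⁻¹ ^ (k + 1) * (4 * avgConst n (k + 1) / 2 ^ n))
        = (8 * (8 * n * Real.sqrt n * ε) * Real.sqrt n * ε⁻¹) ^ (k + 1) * (4 * avgConst n (k + 1) / 2 ^ n) := by
          rw [hCdef, ← mul_assoc, ← mul_pow]
      _ = (64 * (n : ℝ) ^ 2 * (ε * ε⁻¹)) ^ (k + 1) * (4 * avgConst n (k + 1) / 2 ^ n) := by
          congr 2
          calc 8 * (8 * n * Real.sqrt n * ε) * Real.sqrt n * ε⁻¹ = 64 * n * (Real.sqrt n * Real.sqrt n) * (ε * ε⁻¹) := by ring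
            _ = 64 * (n : ℝ) ^ 2 * (ε * ε⁻¹) := by rw [hsqrt]; ring
      _ = (64 * (n : ℝ) ^ 2) ^ (k + 1) * (4 * avgConst n (k + 1) / 2 ^ n) := by rw [mul_pow, hεk, mul_one]
  have hmassP : (A 0).mass ≤ ENNReal.ofReal (deformConstP n k) * T.mass := by
    refine (T.mass_admPushLim_le b hTm hsupp hv.continuous (hadm 0) hC hε R hvε hI).trans ?_
    rw [← hconstP, mul_assoc]
    refine mul_le_mul' le_rfl ?_
    simpa only [mul_assoc] using hIle
  have hmassSH : ∀ j, (SH j).mass ≤ ENNReal.ofReal (ε * (2 * n * 15 ^ (k + 1) * deformConstP n k)) * T.mass := by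
    intro j
    refine (T.mass_admHomLim_le b hTm hsupp hv.continuous (hadm j) (hadm (j + 1)) hC hη₀ (hclose j) hε R hvε hI).trans ?_
    unfold admHomConst
    calc ENNReal.ofReal (Real.sqrt n * η₀) * 15 ^ (k + 1) * admConst n C k * ∫⁻ x, admWeight v k x ∂T.variation
        ≤ ENNReal.ofReal (Real.sqrt n * η₀) * 15 ^ (k + 1) * admConst n C k *
            (ENNReal.ofReal (ε⁻¹ ^ (k + 1)) * (ENNReal.ofReal (4 * avgConst n (k + 1) / 2 ^ n) * T.mass)) :=
          mul_le_mul' le_rfl hIle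
      _ = ENNReal.ofReal (Real.sqrt n * η₀) * 15 ^ (k + 1) * (admConst n C k *
            (ENNReal.ofReal (ε⁻¹ ^ (k + 1)) * ENNReal.ofReal (4 * avgConst n (k + 1) / 2 ^ n))) * T.mass := by ring
      _ = ENNReal.ofReal (ε * (2 * n * 15 ^ (k + 1) * deformConstP n k)) * T.mass := by
          rw [hconstP]
          congr 1
          have hdP := deformConstP_nonneg n k
          rw [show (15 : ℝ≥0∞) ^ (k + 1) = ENNReal.ofReal (15 ^ (k + 1)) by
              rw [ENNReal.ofReal_pow (by norm_num)]; norm_num,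
            ← ENNReal.ofReal_mul (by positivity), ← ENNReal.ofReal_mul (by positivity)]
          congr 1
          rw [hη₀def]
          calc Real.sqrt n * (2 * Real.sqrt n * ε) * 15 ^ (k + 1) * deformConstP n k
              = 2 * (Real.sqrt n * Real.sqrt n) * ε * 15 ^ (k + 1) * deformConstP n k := by ring
            _ = ε * (2 * n * 15 ^ (k + 1) * deformConstP n k) := by rw [hsqrt]; ring
  have hmassSL : SL.mass ≤ ENNReal.ofReal (Real.sqrt n * ε) * T.mass := by
    refine T.mass_affineHomotopy_le _ _ hgNs contDiff_id (by positivity) hρabs fun t _ x _ => ?_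
    have hD : fderiv ℝ (g N) x = ContinuousLinearMap.id ℝ V := by
      rw [hgN]; rw [fderiv_add_const]; exact fderiv_id
    rw [hD, fderiv_id, sub_self, smul_zero, add_zero]
    have h1 : ‖(ContinuousLinearMap.id ℝ V : V →L[ℝ] V)‖ ^ (k + 1) ≤ 1 :=
      pow_le_one₀ (norm_nonneg _) ContinuousLinearMap.norm_id_le
    have h2 : ‖id x - g N x‖ ≤ δ := by
      rw [hgN]; simp only [id_eq, sub_add_cancel_left, norm_neg]; exact haV
    calc |T.cutoff hsupp x| * ‖id x - g N x‖ * ‖(ContinuousLinearMap.id ℝ V : V →L[ℝ] V)‖ ^ (k + 1)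
        ≤ 1 * δ * 1 := mul_le_mul (mul_le_mul (hχabs x) h2 (norm_nonneg _) zero_le_one) h1 (by positivity)
          (by positivity)
      _ = Real.sqrt n * ε := by rw [hδ]; ring
  /- Step 8: conclusion. -/
  refine ⟨A 0, SL + ∑ j ∈ Finset.range N, SH j, ?_, hPr, ?_, ?_, ?_, hPZ, ?_, hmassP, ?_⟩
  · -- `T = P + ∂S`
    rw [Current.boundary_add, ← htel, ← hlast]; abel
  · exact T.boundary_admPushLim_of_cycle b hTm hcyc hsupp hv (hadm 0) hC hε hvε hI R
  · exact hSLr.add_top (Current.IsRectifiable.finset_sum_top SH hSHr N)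
  · refine T.support_admPushLim_subset b hTm hsupp hv.continuous (hadm 0) hC hε R hvε hI (isClosed_skeletonV b)
      fun x hx => ?_
    simp only [hgdef, add_zero]
    exact gσ_mem_skeletonV b hε le_rfl hx
  · exact (Current.support_add_subset _ _).trans (Set.union_subset hSLZ (Current.support_finset_sum_subset SH hSHZ N))
  · -- mass of `S`
    have hN' : (N : ℝ) ≤ n := by exact_mod_cast (Nat.sub_le n (k + 1))
    have hdP := deformConstP_nonneg n k
    calc (SL + ∑ j ∈ Finset.range N, SH j).mass ≤ SL.mass + (∑ j ∈ Finset.range N, SH j).mass := Current.mass_add_le _ _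
      _ ≤ ENNReal.ofReal (Real.sqrt n * ε) * T.mass +
          ∑ j ∈ Finset.range N, ENNReal.ofReal (ε * (2 * n * 15 ^ (k + 1) * deformConstP n k)) * T.mass :=
          add_le_add hmassSL ((Current.mass_finset_sum_le SH N).trans (Finset.sum_le_sum fun j _ => hmassSH j))
      _ = (ENNReal.ofReal (Real.sqrt n * ε) + (N : ℝ≥0∞) * ENNReal.ofReal (ε * (2 * n * 15 ^ (k + 1) * deformConstP n k))) *
            T.mass := by
          rw [Finset.sum_const, Finset.card_range, nsmul_eq_mul, add_mul, mul_assoc]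
          ring
      _ ≤ ENNReal.ofReal (ε * deformConstS n k) * T.mass := by
          refine mul_le_mul' ?_ le_rfl
          rw [show (N : ℝ≥0∞) = ENNReal.ofReal (N : ℝ) by rw [ENNReal.ofReal_natCast],
            ← ENNReal.ofReal_mul (Nat.cast_nonneg N), ← ENNReal.ofReal_add (by positivity) (by positivity)]
          refine ENNReal.ofReal_le_ofReal ?_
          unfold deformConstS
          have h15 : (0 : ℝ) ≤ 15 ^ (k + 1) := by positivity
          nlinarith [mul_nonneg (mul_nonneg (mul_nonneg hε.le (by positivity : (0:ℝ) ≤ 2 * n)) h15) hdP,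
            Real.sqrt_nonneg n]

end DeformationCycle

/-! ### Total boundedness of integral cycles (Federer 4.2.17, cycle case) -/

section TotallyBounded

open Cubical

variable {V : Type*} [NormedAddCommGroup V] [InnerProductSpace ℝ V] [FiniteDimensional ℝ V]
  [MeasurableSpace V] [BorelSpace V]

/-- **Total boundedness of bounded families of integral cycles in the integral flat norm**
[Federer1969, 4.2.17, proof: "T − f_# P ∈ … 𝓕_K(T − f_# P) ≤ …" with `Ψ₂` finite]: for every
`δ > 0` there is a finite set `Pset` of currents such that every integral cycle `T ∈ 𝓡_{k+1}(V)`,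
`∂T = 0`, with `spt T ⊆ 𝔹(x₀, ρ)` and `𝐌(T) ≤ c` is `δ`-close in `integralFlatNorm` to some
`P ∈ Pset` (deformation at a scale `ε` with `ε γ_S c ≤ δ`, and finiteness of the polyhedral `P`,
`Cubical.finite_setOf_polyhedral`). [cite: Federer1969, 4.2.9, 4.2.17] -/
theorem Current.exists_finite_flatNet_cycles (k : ℕ) (x₀ : V) (ρ : ℝ) {c : ℝ≥0∞} (hc : c ≠ ⊤)
    {δ : ℝ} (hδ : 0 < δ) :
    ∃ Pset : Set (Current (⊤ : Opens V) (k + 1)), Pset.Finite ∧ (∀ P ∈ Pset, P.IsRectifiable ∧ P.boundary = 0) ∧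
      ∀ T : Current (⊤ : Opens V) (k + 1), T.IsRectifiable → T.boundary = 0 →
        T.support ⊆ closedBall x₀ ρ → T.mass ≤ c → ∃ P ∈ Pset, (T - P).integralFlatNorm ≤ ENNReal.ofReal δ := by
  classical
  set n := Module.finrank ℝ V with hn
  by_cases hkn : k + 1 ≤ n
  · set b : OrthonormalBasis (Fin n) ℝ V := stdOrthonormalBasis ℝ V
    -- the scale
    set γ : ℝ := deformConstS n k with hγ
    have hγ0 : 0 ≤ γ := by
      rw [hγ]; unfold deformConstS; have := deformConstP_nonneg n k; positivity
    set ε : ℝ := δ / (γ * c.toReal + 1) with hεdef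
    have hε : 0 < ε := div_pos hδ (by positivity)
    have hεγ : ENNReal.ofReal (ε * γ) * c ≤ ENNReal.ofReal δ := by
      rw [← ENNReal.ofReal_toReal hc, ← ENNReal.ofReal_mul (by positivity)]
      refine ENNReal.ofReal_le_ofReal ?_
      rw [hεdef, div_mul_eq_mul_div, div_mul_eq_mul_div, div_le_iff₀ (by positivity)]
      nlinarith [mul_nonneg hγ0 (ENNReal.toReal_nonneg (a := c))]
    -- the finite set
    set K' : Set V := cthickening (3 * Real.sqrt n * ε) (closedBall x₀ ρ)
    have hK' : Bornology.IsBounded K' := isBounded_closedBall.cthickening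
    set M : ℝ≥0∞ := ENNReal.ofReal (deformConstP n k) * c
    have hM : M ≠ ⊤ := ENNReal.mul_ne_top ENNReal.ofReal_ne_top hc
    set Pset : Set (Current (⊤ : Opens V) (k + 1)) := {P | P.IsRectifiable ∧ P.support ⊆ K' ∧
      P.support ⊆ skeletonV b (k + 1) ε ∧
      (∀ φ : TestForm (⊤ : Opens V) k, tsupport ⇑φ ∩ skeletonV b k ε = ∅ → P.boundary φ = 0) ∧ P.mass ≤ M} ∩
      {P | P.boundary = 0}
    refine ⟨Pset, (finite_setOf_polyhedral b hε k hK' hM).subset Set.inter_subset_left,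
      fun P hP => ⟨hP.1.1, hP.2⟩, fun T hT hcyc hTs hTc => ?_⟩
    obtain ⟨P, S, hTPS, hPr, hPb, hSr, hPsk, hPZ, -, hPm, hSm⟩ :=
      hT.exists_deformation_of_cycle b hkn hε hcyc
    refine ⟨P, ⟨⟨hPr, hPZ.trans (cthickening_subset_of_subset _ hTs), hPsk, fun φ _ => by rw [hPb]; rfl,
      hPm.trans (mul_le_mul' le_rfl hTc)⟩, hPb⟩, ?_⟩
    have hTP : T - P = 0 + S.boundary := by rw [zero_add]; nth_rewrite 1 [hTPS]; abel
    refine (Current.integralFlatNorm_le_of_eq Current.isRectifiable_zero hSr hTP).trans ?_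
    rw [Current.mass_zero, zero_add]
    exact hSm.trans ((mul_le_mul' le_rfl hTc).trans hεγ)
  · -- `dim V < k + 1`: all rectifiable `(k+1)`-currents vanish
    refine ⟨{0}, Set.finite_singleton _, fun P hP => ?_, fun T hT _ _ _ => ⟨0, Set.mem_singleton _, ?_⟩⟩
    · rw [Set.mem_singleton_iff.1 hP]
      exact ⟨Current.isRectifiable_zero, by ext φ; rfl⟩
    · rw [hT.1.eq_zero_of_finrank_lt (by omega), sub_zero, Current.integralFlatNorm_zero]
      exact bot_le

end TotallyBounded

end Literature.Geometry.GeometricMeasureTheory
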